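import Summits.FinalStateConjecture.FinalStateConjecture.Theorems.ClusterCompletenessOmegaLimitMultiKerrEternalFamilies
import Summits.FinalStateConjecture.FinalStateConjecture.Theorems.ClusterCompletenessOmegaLimitMultiKerrBarbalat
import HarnessLib

/-!
# Route ClusterCompleteness · crux `OmegaLimitMultiKerr` — FATOU form of the invariance principle:
# a nonnegative flux whose late WINDOW integrals vanish is zero on almost every time-translate of
# every ω-limit (no uniform continuity in time)

Structure lemma for the crux stmt-FinalStateConjecture-14664 (`ClusterCompleteness.OmegaLimitMultiKerr`,
rank 9), line `Sketch`, lead gen 5, registered stub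
`ae_flux_omegaLimit_translate_eq_zero_of_tendsto_setIntegral` (closed form).

LaSalle reading of the crux: the late-time TRANSLATES `x ↦ h (x + t • e)` of a chart field `h` on a
domain `O` invariant under the translations `x ↦ x + s • e`; "`g` is an ω-limit of `h` along `T`"
means `T n → +∞` and `supCkENorm K k (h (· + T n • e) − g) → 0` for every compact `K ⊆ O`. The
invariance principle landed in `…InvariancePrinciple` says: if the flux `t ↦ Φ (h (· + t • e))` tends
to `0` and `Φ` is sequentially continuous along the orbit, then `Φ (g (· + s • e)) = 0` for EVERY
`s`. But the energy identities of general relativity (Bondi mass loss, area increase) only give a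
finite integrated budget, i.e. vanishing late WINDOW integrals `∫_{[t, t + L]} Φ → 0`
(`tendsto_setIntegral_Icc_add_of_integrableOn`, file `…Barbalat`), and upgrading this to pointwise
decay needs uniform continuity in time (Barbalat's lemma). This file proves the FATOU form, which
needs no uniform continuity: window integrals `→ 0` plus continuity of `Φ` along the orbit already
force `Φ (g (· + s • e)) = 0` for ALMOST EVERY `s` (Lebesgue); and for every `s` as soon as
`s ↦ Φ (g (· + s • e))` is continuous.

* `ae_restrict_eq_zero_of_tendsto_of_tendsto_setIntegral_Icc` — pure real analysis, one window:
  `F ≥ 0` continuous on `Ici a` with `∫_{[t, t + L]} F → 0`, `T n → +∞` and `F (T n + s) → G s` for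
  every `s`; then `G = 0` a.e. on `[s₀, s₀ + L]`. Proof: Fatou's lemma on the window,
  `∫_{[s₀, s₀+L]} G ≤ liminf ∫_{[s₀, s₀+L]} F (T n + ·) = liminf ∫_{[T n + s₀, T n + s₀ + L]} F = 0`
  (translation invariance of Lebesgue measure), and `G ≥ 0`.
* `ae_eq_zero_of_tendsto_of_tendsto_setIntegral_Icc` — the same on the whole line (`0 < L`; cover `ℝ`
  by the windows `[m L, m L + L]`, `m ∈ ℤ`); `eq_zero_of_tendsto_of_tendsto_setIntegral_Icc` — every
  `s` when `G` is continuous.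
* `ae_flux_omegaLimit_translate_eq_zero_of_tendsto_setIntegral` (registered stub) — the Fatou form of
  the invariance principle in the `Cᵏ_loc`-translate currency: by the eternal-families lemma
  `tendsto_supCkENorm_translate_add_shift` the ω-limit along `T n + s` is `g (· + s • e)`, so the
  orbit continuity of `Φ` gives `Φ (h (· + (T n + s) • e)) → Φ (g (· + s • e))` for every `s`, and the
  real-analysis lemma applies.
* `flux_omegaLimit_translate_eq_zero_of_tendsto_setIntegral_of_continuous` — rider: if moreover
  `s ↦ Φ (g (· + s • e))` is continuous, then `Φ (g (· + s • e)) = 0` for EVERY `s` (a continuous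
  function vanishing Lebesgue-a.e. vanishes; `volume` is positive on open sets).

LaSalle 1960; Hale 1980, Ch. X, §1 (invariance principle); the a.e. form is the standard Fatou
argument. Everything is proved; Mathlib + the landed `…EternalFamilies` / `…Barbalat` files only; no
definitions.
-/

-- every `Summit.FinalStateConjecture.FinalStateConjecture.…` name repeats the summit = sub-problem segment (D-0017 layout)
set_option linter.dupNamespace false

noncomputable section

open Set Filter Topology Function
open scoped ContDiff Topology ENNReal

namespace Summit.FinalStateConjecture.FinalStateConjecture.Theorems.ClusterCompleteness

open Literature.Geometry.Lorentzian MeasureTheory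

/-! ### Fatou on late windows (pure real analysis) -/

/-- **Fatou on one window.** Let `F ≥ 0` be continuous on a half-line `Ici a` with vanishing late
window integrals `∫_{[t, t + L]} F → 0` (`t → +∞`), let `T n → +∞`, and suppose the shifted functions
converge pointwise, `F (T n + s) → G s` for every `s`. Then `G = 0` almost everywhere on the window
`[s₀, s₀ + L]`: by Fatou's lemma and the translation invariance of Lebesgue measure,
`∫_{[s₀, s₀+L]} G ≤ liminfₙ ∫_{[T n + s₀, T n + s₀ + L]} F = 0`, while `G ≥ 0`. [folklore] -/
theorem ae_restrict_eq_zero_of_tendsto_of_tendsto_setIntegral_Icc {F G : ℝ → ℝ} {a L s₀ : ℝ}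
    {T : ℕ → ℝ} (h0 : ∀ t ∈ Ici a, 0 ≤ F t) (hcont : ContinuousOn F (Ici a))
    (hw : Tendsto (fun t ↦ ∫ s in Icc t (t + L), F s) atTop (𝓝 0))
    (hT : Tendsto T atTop atTop) (hG : ∀ s, Tendsto (fun n ↦ F (T n + s)) atTop (𝓝 (G s))) :
    ∀ᵐ s ∂volume.restrict (Icc s₀ (s₀ + L)), G s = 0 := by
  -- WLOG every shifted window `T n + [s₀, s₀ + L]` lies in the half-line `Ici a`
  wlog ha : ∀ n, a ≤ T n + s₀ generalizing T
  · obtain ⟨N, hN⟩ := eventually_atTop.1 (hT.eventually_ge_atTop (a - s₀))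
    exact this (T := fun n ↦ T (n + N)) (hT.comp (tendsto_add_atTop_nat N))
      (fun s ↦ (hG s).comp (tendsto_add_atTop_nat N))
      fun n ↦ by have h := hN (n + N) (Nat.le_add_left N n); linarith
  have hwin : ∀ n, ∀ s ∈ Icc s₀ (s₀ + L), T n + s ∈ Ici a := fun n s hs ↦ by
    have h1 := ha n
    have h2 := hs.1
    rw [mem_Ici]
    linarith
  -- the limit is nonnegative on the window
  have hG0 : ∀ s ∈ Icc s₀ (s₀ + L), 0 ≤ G s := fun s hs ↦
    ge_of_tendsto' (hG s) fun n ↦ h0 _ (hwin n s hs)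
  -- the shifted functions are continuous, hence a.e.-measurable and integrable, on the window
  have hc : ∀ n, ContinuousOn (fun s ↦ F (T n + s)) (Icc s₀ (s₀ + L)) := fun n ↦
    hcont.comp (continuous_const.add continuous_id).continuousOn (hwin n)
  have hm : ∀ n, AEMeasurable (fun s ↦ F (T n + s)) (volume.restrict (Icc s₀ (s₀ + L))) :=
    fun n ↦ (hc n).aemeasurable measurableSet_Icc
  have hGm : AEMeasurable G (volume.restrict (Icc s₀ (s₀ + L))) :=
    aemeasurable_of_tendsto_metrizable_ae' hm (ae_of_all _ fun s ↦ hG s)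
  -- the window integrals of the shifted functions are late window integrals of `F`
  have hI : ∀ n, ∫⁻ s in Icc s₀ (s₀ + L), ENNReal.ofReal (F (T n + s)) =
      ENNReal.ofReal (∫ s in Icc (T n + s₀) (T n + s₀ + L), F s) := by
    intro n
    rw [← ofReal_integral_eq_lintegral_ofReal (f := fun s ↦ F (T n + s)) (hc n).integrableOn_Icc
      ((ae_restrict_mem measurableSet_Icc).mono fun s hs ↦ h0 _ (hwin n s hs))]
    congr 1
    have h := (measurePreserving_add_left volume (T n)).setIntegral_image_emb
      (measurableEmbedding_addLeft (T n)) F (Icc s₀ (s₀ + L))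
    rw [image_const_add_Icc, ← add_assoc] at h
    exact h.symm
  -- … and these tend to `0`
  have hI0 : Tendsto (fun n ↦ ∫⁻ s in Icc s₀ (s₀ + L), ENNReal.ofReal (F (T n + s))) atTop
      (𝓝 0) := by
    simp only [hI]
    rw [← ENNReal.ofReal_zero]
    exact ENNReal.tendsto_ofReal (hw.comp (tendsto_atTop_add_const_right _ _ hT))
  -- Fatou's lemma
  have hF : ∫⁻ s in Icc s₀ (s₀ + L), ENNReal.ofReal (G s) = 0 := by
    refine le_antisymm ?_ zero_le
    calc ∫⁻ s in Icc s₀ (s₀ + L), ENNReal.ofReal (G s)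
        = ∫⁻ s in Icc s₀ (s₀ + L), liminf (fun n ↦ ENNReal.ofReal (F (T n + s))) atTop :=
          lintegral_congr fun s ↦ ((ENNReal.tendsto_ofReal (hG s)).liminf_eq).symm
      _ ≤ liminf (fun n ↦ ∫⁻ s in Icc s₀ (s₀ + L), ENNReal.ofReal (F (T n + s))) atTop :=
          lintegral_liminf_le' fun n ↦ (hm n).ennreal_ofReal
      _ = 0 := hI0.liminf_eq
  -- hence `G = 0` a.e. on the window
  filter_upwards [(lintegral_eq_zero_iff' hGm.ennreal_ofReal).1 hF,
    ae_restrict_mem measurableSet_Icc] with s hs hsI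
  exact le_antisymm (ENNReal.ofReal_eq_zero.1 hs) (hG0 s hsI)

/-- **Fatou on the line.** Let `F ≥ 0` be continuous on a half-line `Ici a` with vanishing late
window integrals `∫_{[t, t + L]} F → 0` for some `L > 0`, let `T n → +∞`, and suppose
`F (T n + s) → G s` for every `s`. Then `G = 0` Lebesgue-almost everywhere (cover `ℝ` by the
windows `[m L, (m + 1) L]`, `m ∈ ℤ`). This is the Fatou substitute for Barbalat's lemma: no
uniform continuity of `F` is needed, at the price of an exceptional null set of shifts. [folklore] -/
theorem ae_eq_zero_of_tendsto_of_tendsto_setIntegral_Icc {F G : ℝ → ℝ} {a L : ℝ} {T : ℕ → ℝ}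
    (hL : 0 < L) (h0 : ∀ t ∈ Ici a, 0 ≤ F t) (hcont : ContinuousOn F (Ici a))
    (hw : Tendsto (fun t ↦ ∫ s in Icc t (t + L), F s) atTop (𝓝 0))
    (hT : Tendsto T atTop atTop) (hG : ∀ s, Tendsto (fun n ↦ F (T n + s)) atTop (𝓝 (G s))) :
    ∀ᵐ s, G s = 0 := by
  have h : ∀ᵐ s ∂volume.restrict (⋃ m : ℤ, Icc (m • L) ((m + 1) • L)), G s = 0 :=
    (ae_restrict_iUnion_iff _ _).2 fun m ↦ by
      rw [add_one_zsmul]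
      exact ae_restrict_eq_zero_of_tendsto_of_tendsto_setIntegral_Icc h0 hcont hw hT hG
  rwa [iUnion_Icc_zsmul hL, Measure.restrict_univ] at h

/-- **Every shift, for a continuous limit.** In the setting of
`ae_eq_zero_of_tendsto_of_tendsto_setIntegral_Icc`, if the limit function `G` is continuous then
`G s = 0` for EVERY `s` (a continuous function vanishing Lebesgue-a.e. vanishes identically:
Lebesgue measure charges every nonempty open set). [folklore] -/
theorem eq_zero_of_tendsto_of_tendsto_setIntegral_Icc {F G : ℝ → ℝ} {a L : ℝ} {T : ℕ → ℝ}
    (hL : 0 < L) (h0 : ∀ t ∈ Ici a, 0 ≤ F t) (hcont : ContinuousOn F (Ici a))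
    (hw : Tendsto (fun t ↦ ∫ s in Icc t (t + L), F s) atTop (𝓝 0))
    (hT : Tendsto T atTop atTop) (hG : ∀ s, Tendsto (fun n ↦ F (T n + s)) atTop (𝓝 (G s)))
    (hGc : Continuous G) (s : ℝ) : G s = 0 :=
  congrFun ((hGc.ae_eq_iff_eq volume continuous_const).1
    (ae_eq_zero_of_tendsto_of_tendsto_setIntegral_Icc hL h0 hcont hw hT hG)) s

/-! ### The Fatou form of the invariance principle -/

/-- **Invariance principle, Fatou form** (registered structure stub of line `Sketch`, crux
stmt-FinalStateConjecture-14664; closed form). Let `O` be invariant under all translations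
`x ↦ x + s • e`, `h : E → W` the orbit's field and `Φ` a real functional (a local flux) such that
along the orbit `t ↦ Φ (h (· + t • e))` is nonnegative and continuous on a half-line `Ici a`, with
vanishing late WINDOW integrals `∫_{[t, t + L]} Φ (h (· + s • e)) ds → 0` for some `L > 0` (a finite
radiated budget, `tendsto_setIntegral_Icc_add_of_integrableOn`), and such that `Φ` is sequentially
continuous ALONG THE ORBIT (translates `h (· + tₙ • e)`, `tₙ → +∞`, converging to `g'` in
`supCkENorm K k` on every compact `K ⊆ O` have `Φ (h (· + tₙ • e)) → Φ g'`). Then for every ω-limit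
`g` of `h` (along some `Tₙ → +∞`), `Φ (g (· + s • e)) = 0` for ALMOST EVERY `s ∈ ℝ`. No uniform
continuity in time is needed (contrast `flux_omegaLimit_translate_eq_zero_of_integrableOn`):
eternal families (`tendsto_supCkENorm_translate_add_shift`) + Fatou's lemma on windows
(`ae_eq_zero_of_tendsto_of_tendsto_setIntegral_Icc`). LaSalle 1960; Hale 1980, Ch. X, §1.
[cite: Hale1980, Ch. X §1] -/
theorem ae_flux_omegaLimit_translate_eq_zero_of_tendsto_setIntegral :
    ∀ {E : Type*} [NormedAddCommGroup E] [NormedSpace ℝ E]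
      {W : Type*} [NormedAddCommGroup W] [NormedSpace ℝ W]
      {O : Set E} {e : E}, (∀ x ∈ O, ∀ s : ℝ, x + s • e ∈ O) →
      ∀ {k : ℕ} {h : E → W} (Φ : (E → W) → ℝ) {a L : ℝ}, 0 < L →
      (∀ t ∈ Ici a, 0 ≤ Φ (fun x ↦ h (x + t • e))) →
      ContinuousOn (fun t : ℝ ↦ Φ (fun x ↦ h (x + t • e))) (Ici a) →
      Tendsto (fun t ↦ ∫ s in Icc t (t + L), Φ (fun x ↦ h (x + s • e))) atTop (𝓝 0) →
      (∀ (t : ℕ → ℝ) (g' : E → W), Tendsto t atTop atTop →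
        (∀ K ⊆ O, IsCompact K →
          Tendsto (fun n ↦ supCkENorm K k (fun x ↦ h (x + t n • e) - g' x)) atTop (𝓝 0)) →
        Tendsto (fun n ↦ Φ (fun x ↦ h (x + t n • e))) atTop (𝓝 (Φ g'))) →
      ∀ {g : E → W} {T : ℕ → ℝ}, Tendsto T atTop atTop →
      (∀ K ⊆ O, IsCompact K →
        Tendsto (fun n ↦ supCkENorm K k (fun x ↦ h (x + T n • e) - g x)) atTop (𝓝 0)) →
      ∀ᵐ s : ℝ, Φ (fun x ↦ g (x + s • e)) = 0 := by
  intro E _ _ W _ _ O e hO k h Φ a L hL h0 hcont hw hΦ g T hT hlim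
  -- eternal families: along the shifted times `T n + s` the translates converge to `g (· + s • e)`,
  -- so the flux converges to its value there
  have hG : ∀ s : ℝ, Tendsto (fun n ↦ Φ (fun x ↦ h (x + (T n + s) • e))) atTop
      (𝓝 (Φ (fun x ↦ g (x + s • e)))) := fun s ↦
    hΦ (fun n ↦ T n + s) (fun x ↦ g (x + s • e)) (tendsto_atTop_add_const_right _ _ hT)
      (tendsto_supCkENorm_translate_add_shift hO hlim s)
  exact ae_eq_zero_of_tendsto_of_tendsto_setIntegral_Icc (F := fun t ↦ Φ (fun x ↦ h (x + t • e)))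
    (G := fun s ↦ Φ (fun x ↦ g (x + s • e))) hL h0 hcont hw hT hG

/-- **Invariance principle, Fatou form, continuous flux on the limit.** Under the hypotheses of
`ae_flux_omegaLimit_translate_eq_zero_of_tendsto_setIntegral`, if moreover the flux is continuous
in time on the ω-limit, `Continuous (s ↦ Φ (g (· + s • e)))` (e.g. `g` tame and `Φ` continuous in
`supCkENorm` on a compact), then `Φ (g (· + s • e)) = 0` for EVERY `s ∈ ℝ`: the ω-limit does not
radiate at any time. LaSalle 1960; Hale 1980, Ch. X, §1. [cite: Hale1980, Ch. X §1] -/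
theorem flux_omegaLimit_translate_eq_zero_of_tendsto_setIntegral_of_continuous :
    ∀ {E : Type*} [NormedAddCommGroup E] [NormedSpace ℝ E]
      {W : Type*} [NormedAddCommGroup W] [NormedSpace ℝ W]
      {O : Set E} {e : E}, (∀ x ∈ O, ∀ s : ℝ, x + s • e ∈ O) →
      ∀ {k : ℕ} {h : E → W} (Φ : (E → W) → ℝ) {a L : ℝ}, 0 < L →
      (∀ t ∈ Ici a, 0 ≤ Φ (fun x ↦ h (x + t • e))) →
      ContinuousOn (fun t : ℝ ↦ Φ (fun x ↦ h (x + t • e))) (Ici a) →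
      Tendsto (fun t ↦ ∫ s in Icc t (t + L), Φ (fun x ↦ h (x + s • e))) atTop (𝓝 0) →
      (∀ (t : ℕ → ℝ) (g' : E → W), Tendsto t atTop atTop →
        (∀ K ⊆ O, IsCompact K →
          Tendsto (fun n ↦ supCkENorm K k (fun x ↦ h (x + t n • e) - g' x)) atTop (𝓝 0)) →
        Tendsto (fun n ↦ Φ (fun x ↦ h (x + t n • e))) atTop (𝓝 (Φ g'))) →
      ∀ {g : E → W} {T : ℕ → ℝ}, Tendsto T atTop atTop →
      (∀ K ⊆ O, IsCompact K →
        Tendsto (fun n ↦ supCkENorm K k (fun x ↦ h (x + T n • e) - g x)) atTop (𝓝 0)) →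
      Continuous (fun s : ℝ ↦ Φ (fun x ↦ g (x + s • e))) →
      ∀ s : ℝ, Φ (fun x ↦ g (x + s • e)) = 0 := by
  intro E _ _ W _ _ O e hO k h Φ a L hL h0 hcont hw hΦ g T hT hlim hgc s
  have hae := ae_flux_omegaLimit_translate_eq_zero_of_tendsto_setIntegral hO Φ hL h0 hcont hw hΦ
    hT hlim
  exact congrFun ((hgc.ae_eq_iff_eq volume continuous_const).1 hae) s

end Summit.FinalStateConjecture.FinalStateConjecture.Theorems.ClusterCompleteness

end
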